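import Mathlib
import Literature.MathematicalPhysics.KineticTheory.HardSphereEntranceProofs
import HarnessLib

/-!
# `OneFlightGossipEngine.OneFlightLayeredChaos` — the LAW OF THE ENTRANCE PARAMETERS of a free flight against a sphere
(crux stmt-AtomisticToContinuum-14535, line `Sketch`, brick for the `n = 0` / fresh-partner rung `stub_firstFlight_flux`;
registered stub `lintegral_entranceLaw_pair`; stub worker of lead cycle c3, 2026-08-16)

From the tree's entrance parametrisation `hardSphere_entranceParametrization_holds` (Spohn 1991 (8.132):
`dc = ε^{m-1} (v·ω)₊ dt dω` on the open tube of radius `ε` around the free path `x + ℝv`) we derive its CHANGE-OF-VARIABLES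
form: if `(tE, ωE)` is any measurable left inverse of the parametrisation `(t, ω) ↦ x + tv + εω` on the entrance
hemisphere `{v·ω > 0}`, then for every measurable `H(t, ω) ≥ 0`
`∫_{tube} H(tE c, ωE c) dc = ∫_{S^{m-1}} ∫_ℝ H(t, ω) ε^{m-1}(v·ω)₊ dt dω` (`lintegral_entranceLaw`): the joint law of
(entrance time, entrance normal) of a point uniformly distributed in the tube is `ε^{m-1}(v·ω)₊ dt dω` — given the
entrance time the normal is FLUX (cosine-law) distributed on the entrance hemisphere. The explicit left inverse
(`entrance_leftInverse`): with `e = v/‖v‖`, `y = c − x`, `y⊥ = y − ⟪y,e⟫e`,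
`tE c = (⟪y, e⟫ − ε √(1 − ‖y⊥‖²/ε²))/‖v‖`, `ωE c = ε⁻¹ (y − (tE c) v)`.
In the collision setting of the crux (relative position `q = x_i − x_j` uniform, relative velocity `g = v_i − v_j`,
contact when `‖q + t g‖ = ε`, contact normal `ω = (q + t g)/ε`, incoming `⟪g, ω⟫ < 0`) take `x = 0`, `v = −g`, `c = q`.
No definitions; Mathlib + the tree only.
-/

open MeasureTheory Metric Real Set
open scoped InnerProductSpace ENNReal

namespace Summit.AtomisticToContinuum.HydrodynamicLimit.Theorems.OLC

variable {E : Type*} [NormedAddCommGroup E] [InnerProductSpace ℝ E] [FiniteDimensional ℝ E]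
  [MeasurableSpace E] [BorelSpace E]

/-- **Law of the entrance parameters.** Let `v ≠ 0`, `ε > 0`, and let `(tE, ωE)` be measurable and a left inverse of the
entrance parametrisation on the entrance hemisphere: `tE (x + tv + εω) = t`, `ωE (x + tv + εω) = ω` whenever `‖ω‖ = 1`
and `⟪v, ω⟫ > 0`. Then for every measurable `H : ℝ × E → [0, ∞]`,
`∫_{dist(c, x + ℝv) < ε} H(tE c, ωE c) dc = ∫_{S} ∫_ℝ H(t, ω) ε^{m-1} (v·ω)₊ dt dω`
(`hardSphere_entranceParametrization_holds` applied to `H ∘ (tE, ωE)`; off the entrance hemisphere the Jacobian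
vanishes). [folklore] -/
theorem lintegral_entranceLaw (x v : E) (hv : v ≠ 0) {ε : ℝ} (hε : 0 < ε) {tE : E → ℝ} {ωE : E → E}
    (htE : Measurable tE) (hωE : Measurable ωE)
    (hinv : ∀ (t : ℝ) (ω : E), ‖ω‖ = 1 → 0 < ⟪v, ω⟫_ℝ →
      tE (x + t • v + ε • ω) = t ∧ ωE (x + t • v + ε • ω) = ω)
    (H : ℝ × E → ℝ≥0∞) (hH : Measurable H) :
    ∫⁻ c in {c : E | ∃ t : ℝ, dist c (x + t • v) < ε}, H (tE c, ωE c) =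
      ∫⁻ ω : sphere (0 : E) 1, ∫⁻ t : ℝ, H (t, (ω : E)) *
        ENNReal.ofReal (ε ^ (Module.finrank ℝ E - 1) * max ⟪v, (ω : E)⟫_ℝ 0)
          ∂volume ∂Literature.MathematicalPhysics.KineticTheory.sphereMeasure := by
  have hP := Literature.MathematicalPhysics.KineticTheory.hardSphere_entranceParametrization_holds x v hv hε
    (fun c => H (tE c, ωE c)) (hH.comp (htE.prodMk hωE))
  rw [← hP]
  refine lintegral_congr fun ω => lintegral_congr fun t => ?_
  by_cases hin : 0 < ⟪v, (ω : E)⟫_ℝ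
  · have hω : ‖(ω : E)‖ = 1 := by simp
    obtain ⟨h1, h2⟩ := hinv t (ω : E) hω hin
    simp only [h1, h2]
  · have hmax : max ⟪v, (ω : E)⟫_ℝ 0 = 0 := max_eq_right (not_lt.1 hin)
    simp only [hmax, mul_zero, ENNReal.ofReal_zero]

omit [FiniteDimensional ℝ E] [MeasurableSpace E] [BorelSpace E] in
/-- **The explicit left inverse of the entrance parametrisation.** For `v ≠ 0`, `ε > 0`, `‖ω‖ = 1`, `⟪v, ω⟫ > 0` and
`c = x + tv + εω`: with `e = ‖v‖⁻¹ v`, `y = c − x`, `a = ⟪y, e⟫`, `y⊥ = y − a e`, one has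
`(a − ε √(1 − ‖y⊥‖² / ε²)) / ‖v‖ = t` and `ε⁻¹ (y − t v) = ω` (so the entrance time and the entrance normal are
explicit measurable functions of the point of the tube). [folklore] -/
theorem entrance_leftInverse (x v : E) (hv : v ≠ 0) {ε : ℝ} (hε : 0 < ε) (t : ℝ) (ω : E) (hω : ‖ω‖ = 1)
    (hin : 0 < ⟪v, ω⟫_ℝ) :
    ((⟪x + t • v + ε • ω - x, ‖v‖⁻¹ • v⟫_ℝ -
          ε * Real.sqrt (1 - ‖(x + t • v + ε • ω - x) - ⟪x + t • v + ε • ω - x, ‖v‖⁻¹ • v⟫_ℝ • (‖v‖⁻¹ • v)‖ ^ 2 / ε ^ 2)) /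
        ‖v‖ = t) ∧
      ε⁻¹ • ((x + t • v + ε • ω - x) - t • v) = ω := by
  have hv' : 0 < ‖v‖ := norm_pos_iff.2 hv
  have hvne : ‖v‖ ≠ 0 := hv'.ne'
  set e : E := ‖v‖⁻¹ • v with hedef
  have he : ‖e‖ = 1 := by rw [hedef, norm_smul, norm_inv, norm_norm, inv_mul_cancel₀ hvne]
  have hve : v = ‖v‖ • e := by rw [hedef, smul_smul, mul_inv_cancel₀ hvne, one_smul]
  have hee : ⟪e, e⟫_ℝ = 1 := by rw [real_inner_self_eq_norm_sq, he, one_pow]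
  have hvz : ∀ z : E, ⟪v, z⟫_ℝ = ‖v‖ * ⟪e, z⟫_ℝ := fun z => by
    conv_lhs => rw [hve]
    rw [real_inner_smul_left]
  have htv : t • v = (t * ‖v‖) • e := by
    conv_lhs => rw [hve]
    rw [smul_smul]
  -- the longitudinal component of `ω`
  set a : ℝ := ⟪ω, e⟫_ℝ with hadef
  have ha : 0 < a := by
    have : ⟪v, ω⟫_ℝ = ‖v‖ * a := by rw [hvz ω, real_inner_comm ω e, ← hadef]
    rw [this] at hin
    exact pos_of_mul_pos_right hin hv'.le
  have hy : x + t • v + ε • ω - x = t • v + ε • ω := by abel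
  rw [hy]
  constructor
  · -- the entrance time
    have h1 : ⟪t • v + ε • ω, e⟫_ℝ = t * ‖v‖ + ε * a := by
      rw [inner_add_left, real_inner_smul_left, real_inner_smul_left, hvz e, hee, mul_one, ← hadef]
    have hperp : (t • v + ε • ω) - ⟪t • v + ε • ω, e⟫_ℝ • e = ε • (ω - a • e) := by
      rw [h1, htv, add_smul, smul_sub, smul_smul]
      module
    have hnorm : ‖ε • (ω - a • e)‖ ^ 2 = ε ^ 2 * (1 - a ^ 2) := by
      rw [norm_smul, mul_pow, Real.norm_eq_abs, sq_abs]
      congr 1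
      rw [norm_sub_sq_real, hω, real_inner_smul_right, ← hadef, norm_smul, he, mul_one, Real.norm_eq_abs, sq_abs]
      ring
    have hsqrt : Real.sqrt (1 - ‖ε • (ω - a • e)‖ ^ 2 / ε ^ 2) = a := by
      rw [hnorm, mul_div_cancel_left₀ _ (pow_ne_zero 2 hε.ne'), sub_sub_cancel, Real.sqrt_sq ha.le]
    rw [hperp, hsqrt, h1]
    field_simp
    ring
  · -- the entrance normal
    rw [add_sub_cancel_left, smul_smul, inv_mul_cancel₀ hε.ne', one_smul]

/-- **Law of the entrance parameters, collision convention.** Relative position `q` (uniform on the tube of radius `ε`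
around the line `ℝ g`), relative velocity `g ≠ 0`, contact when `‖q + t g‖ = ε`, contact normal `ω = (q + t g)/ε`,
incoming `⟪g, ω⟫ < 0` (so `q = εω − t g`): for any measurable left inverse `(tE, ωE)` of `(t, ω) ↦ εω − t g` on the
incoming hemisphere and every measurable `H ≥ 0`,
`∫_{dist(q, ℝg) < ε} H(tE q, ωE q) dq = ∫_S ∫_ℝ H(t, ω) ε^{m-1} (−⟪ω, g⟫)₊ dt dω` — the flux (cosine) law of the crux's
`RegimeFluxTail`, jointly with Lebesgue measure in the flight time. [folklore] -/
theorem lintegral_entranceLaw_pair : ∀ {E : Type*} [NormedAddCommGroup E] [InnerProductSpace ℝ E] [FiniteDimensional ℝ E] [MeasurableSpace E] [BorelSpace E] (g : E), g ≠ 0 → ∀ {ε : ℝ}, 0 < ε → ∀ {tE : E → ℝ} {ωE : E → E}, Measurable tE → Measurable ωE → (∀ (t : ℝ) (ω : E), ‖ω‖ = 1 → inner ℝ g ω < 0 → tE (ε • ω - t • g) = t ∧ ωE (ε • ω - t • g) = ω) → ∀ (H : ℝ × E → ENNReal), Measurable H → ∫⁻ q in {q : E | ∃ t : ℝ, dist q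 (t • g) < ε}, H (tE q, ωE q) = ∫⁻ ω : Metric.sphere (0 : E) 1, ∫⁻ t : ℝ, H (t, (ω : E)) * ENNReal.ofReal (ε ^ (Module.finrank ℝ E - 1) * max (-inner ℝ (ω : E) g) 0) ∂MeasureTheory.MeasureSpace.volume ∂Literature.MathematicalPhysics.KineticTheory.sphereMeasure := by
  intro E _ _ _ _ _ g hg ε hε tE ωE htE hωE hinv H hH
  have hinv' : ∀ (t : ℝ) (ω : E), ‖ω‖ = 1 → 0 < ⟪-g, ω⟫_ℝ →
      tE ((0 : E) + t • (-g) + ε • ω) = t ∧ ωE ((0 : E) + t • (-g) + ε • ω) = ω := by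
    intro t ω hω hin
    have hpt : (0 : E) + t • (-g) + ε • ω = ε • ω - t • g := by rw [smul_neg, zero_add, neg_add_eq_sub]
    rw [hpt]
    refine hinv t ω hω ?_
    rwa [inner_neg_left, neg_pos] at hin
  have h := lintegral_entranceLaw (0 : E) (-g) (neg_ne_zero.2 hg) hε htE hωE hinv' H hH
  have hset : {c : E | ∃ t : ℝ, dist c ((0 : E) + t • (-g)) < ε} = {q : E | ∃ t : ℝ, dist q (t • g) < ε} := by
    ext q
    simp only [mem_setOf_eq, zero_add, smul_neg]
    constructor
    · rintro ⟨t, ht⟩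
      exact ⟨-t, by rwa [neg_smul]⟩
    · rintro ⟨t, ht⟩
      exact ⟨-t, by rwa [neg_smul, neg_neg]⟩
  rw [hset] at h
  rw [h]
  refine lintegral_congr fun ω => lintegral_congr fun t => ?_
  rw [inner_neg_left, real_inner_comm]

end Summit.AtomisticToContinuum.HydrodynamicLimit.Theorems.OLC
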